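import Literature.Probability.Percolation.RhombicTilingCornerConsistency
import HarnessLib

/-!
# Planarity of rhombic tilings: the tree's abstract tracks are de Bruijn's ribbons; tracks are simple and meet at most once

Umbrella file (parts X–XI of the planarity series), on top of `RhombicTilingCornerConsistency`.
For a preconnected graph isoradially embedded with the tiling condition and bounded angles
(`PlanarTilingHyps`): the tree's abstract train tracks (`RhombicEmbedding.IsTrack`, defined from
the labels of the sides) coincide with the geometric ribbons (`eq_ribbon_of_isTrack`,
`Ribbon.isTrack_ribbon`); **tracks are simple** (`isSimpleTrack_of_isTrack`); **through every
side of every rhombus passes a track** (`exists_isTrack_through`); **two distinct tracks have at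
most one rhombus in common** (`Ribbon.false_of_two_common`, `meetIndices_subsingleton`) —
Grimmett–Manolescu 2014, §4.2; Kenyon–Schlenker 2005, Thm 3.1; de Bruijn 1981, §4. The two
parts keep their own module docstrings below.
-/

/-!
# Planarity of rhombic tilings, X: the tree's abstract tracks are de Bruijn's ribbons

Topic `Literature/Probability/Percolation`; theorems only. The tree's train tracks
(`RhombicEmbedding.IsTrack`, `IsoradialGraphs`: a bi-infinite sequence of edges `r n` with
*abstract* sides `s n ∈ sides (r n) ∩ sides (r (n+1))`, consecutive shared sides opposite) are
defined from the labels `(v, f)` of the sides, while de Bruijn's ribbons (`Ribbon.seq`,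
`RhombicTilingCornerConsistency`, part VII) were constructed geometrically (shared *segments*).
With corner consistency (part VIII) the two notions coincide, for a preconnected graph
isoradially embedded with the tiling condition and bounded angles (`PlanarTilingHyps`):

* `mem_sides_acrossEdge` — the rhombus across the side `p` has `p` itself as a side (the shared
  segment carries the same labels); `entry_eq_exit_pred` — in a ribbon, the entry side of
  rhombus `n` *is* the exit side of rhombus `n - 1`;
* `isTrack_ribbon` — **every ribbon is a track**; `eq_ribbon_of_isTrack` — **every track is a
  ribbon** (the ribbon through `(r 0, s 0)`);
* `edge_injective`, `isSimpleTrack_of_isTrack` — **tracks are simple** (Grimmett–Manolescu 2014,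
  §4.2: "the rhombi in a track are distinct"; Kenyon–Schlenker 2005, Thm 3.1), because a ribbon is
  a strip with strictly increasing transversal heights;
* `exists_isTrack_through` — **through every side of every rhombus passes a track**, so that
  every rhombus lies on (exactly) two tracks (GM §4.2), the tracks through its two pairs of
  opposite sides (`Ribbon.acrossEdge_lateral_not_mem` for "exactly").

## References

* G. R. Grimmett, I. Manolescu, *Bond percolation on isoradial graphs*, PTRF 159 (2014),
  arXiv:1204.0505, §4.2 (track systems of rhombic tilings).
* R. Kenyon, J.-M. Schlenker, *Rhombic embeddings of planar quad-graphs*, TAMS 357 (2005), Thm 3.1.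
* N. G. de Bruijn, *Algebraic theory of Penrose's non-periodic tilings*, Indag. Math. 43 (1981), §4.
-/

noncomputable section

open Complex ComplexConjugate Metric Set Filter Topology

namespace Literature.Probability.Percolation

open Literature.Probability.LatticeModels IsoradialCriticality

variable {V F : Type*} {G : SimpleGraph V} {emb : RhombicEmbedding G F} {ε : ℝ}
variable [DecidableEq V] [DecidableEq F] (H : PlanarTilingHyps emb ε)

/-- **The rhombus across a side has that very side** (labels included): `p ∈ sides (acrossEdge H e p)`.
[cite: GrimmettManolescu2014Isoradial, §4.2 (consecutive rhombi of a track share a side)] -/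
theorem mem_sides_acrossEdge (e : G.edgeSet) {p : V × F} (hp : p ∈ emb.sides e) :
    p ∈ emb.sides (acrossEdge H e p) := by
  obtain ⟨p', hp', hs'⟩ := exists_side_acrossEdge H e hp
  -- the labels agree, by corner consistency
  have h1 : emb.z p'.1 ∈ ({emb.z p.1, emb.c p.2} : Set ℂ) := by rw [← hs']; simp
  have h2 : emb.c p'.2 ∈ ({emb.z p.1, emb.c p.2} : Set ℂ) := by rw [← hs']; simp
  simp only [mem_insert_iff, mem_singleton_iff] at h1 h2
  have hface : ∀ (e₀ : G.edgeSet) {q : V × F}, q ∈ emb.sides e₀ → ∀ v : V, emb.z v ≠ emb.c q.2 := by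
    intro e₀ q hq v
    change q ∈ emb.dartSides (RhombicEmbedding.refDart e₀) at hq
    rcases (mem_dartSides_iff _ q).1 hq with rfl | rfl | rfl | rfl
    · exact z_ne_c_leftFace H v _
    · exact z_ne_c_leftFace H v _
    · rw [← H.iso.leftFace_symm]; exact z_ne_c_leftFace H v _
    · rw [← H.iso.leftFace_symm]; exact z_ne_c_leftFace H v _
  rcases h1 with h1 | h1
  · rcases h2 with h2 | h2
    · exact absurd h2.symm (hface _ hp' p.1)
    · have : p' = p := Prod.ext (H.iso.z_injective h1) (H.tiling.c_injective h2)
      exact this ▸ hp'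
  · exact absurd h1 (hface e hp p'.1)

namespace Ribbon

variable (x₀ : St emb)

/-- **In a ribbon the entry side of rhombus `n` is the exit side of rhombus `n - 1`** (as
labelled sides, not only as segments). [cite: GrimmettManolescu2014Isoradial, §4.2 (consecutive rhombi of a track share a side)] -/
theorem entry_eq_exit_pred (n : ℤ) : entry H x₀ n = exit H x₀ (n - 1) := by
  have h1 : edge H x₀ n = acrossEdge H (edge H x₀ (n - 1)) (exit H x₀ (n - 1)) := by
    have := edge_succ H x₀ (n - 1); rw [sub_add_cancel] at this; exact this
  have hmem : exit H x₀ (n - 1) ∈ emb.sides (edge H x₀ n) := by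
    rw [h1]; exact mem_sides_acrossEdge H _ (exit_mem H x₀ (n - 1))
  have hpair : ({emb.z (entry H x₀ n).1, emb.c (entry H x₀ n).2} : Set ℂ) =
      {emb.z (exit H x₀ (n - 1)).1, emb.c (exit H x₀ (n - 1)).2} := by
    have := entry_pair_succ H x₀ (n - 1); rw [sub_add_cancel] at this; exact this
  exact side_eq_of_pair_eq H.iso H.tiling _ (entry_mem H x₀ n) hmem hpair

/-- **Every ribbon is a track** in the sense of `RhombicEmbedding.IsTrack`, with side sequence its
exit sides. [cite: GrimmettManolescu2014Isoradial, §4.2 (a track is a doubly infinite sequence of rhombi sharing opposite sides)] -/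
theorem isTrack_ribbon : emb.IsTrack (edge H x₀) := by
  refine ⟨exit H x₀, fun n => ⟨exit_mem H x₀ n, ?_, (edge_succ_ne H x₀ n).symm, ?_⟩⟩
  · rw [edge_succ]; exact mem_sides_acrossEdge H _ (exit_mem H x₀ n)
  · rw [← entry_eq_exit_pred, oppositeSide_entry]

/-- **The rhombi of a ribbon are distinct** (the strip has strictly increasing transversal
heights). [cite: GrimmettManolescu2014Isoradial, §4.2 (the rhombi in a track are distinct)] -/
theorem edge_injective : Function.Injective (edge H x₀) := by
  intro n m h
  set D := stripData H x₀ with hD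
  -- `t (A n) = tn n`, and `A n` is a corner of `edge n = edge m`, whose corners have heights `tn m`, `tn (m+1)`
  have htA : ∀ k, D.t (cA H x₀ k) = D.tn k := by
    intro k
    have : cA H x₀ k ∈ ({L H x₀ k, L H x₀ k + w H x₀} : Set ℂ) := by rw [pair_L]; simp
    rcases this with h' | h'
    · rw [h']; rfl
    · rw [mem_singleton_iff] at h'; rw [h']; exact D.t_L_add_w k
  have htB : ∀ k, D.t (cB H x₀ k) = D.tn (k + 1) := by
    intro k
    have : cB H x₀ k ∈ ({L H x₀ (k + 1), L H x₀ (k + 1) + w H x₀} : Set ℂ) := by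
      rw [pair_L, entry_corners_succ]; simp
    rcases this with h' | h'
    · rw [h']; rfl
    · rw [mem_singleton_iff] at h'; rw [h']; exact D.t_L_add_w (k + 1)
  -- the primal corner sets of `edge n` and `edge m` agree
  obtain ⟨-, -, -, -, hABn, -⟩ := quad H x₀ n
  obtain ⟨-, -, -, -, hABm, -⟩ := quad H x₀ m
  rw [h] at hABn
  have hmem : cA H x₀ n ∈ ({cA H x₀ m, cB H x₀ m} : Set ℂ) := by rw [hABm, ← hABn]; simp
  have hmono := D.tn_strictMono
  rcases hmem with h' | h'
  · have := congrArg D.t h'; rw [htA, htA] at this; exact hmono.injective this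
  · rw [mem_singleton_iff] at h'
    have h1 := congrArg D.t h'; rw [htA, htB] at h1
    -- also `B n ∈ {A m, B m}`
    have hmem2 : cB H x₀ n ∈ ({cA H x₀ m, cB H x₀ m} : Set ℂ) := by rw [hABm, ← hABn]; simp
    rcases hmem2 with h'' | h''
    · have h2 := congrArg D.t h''; rw [htB, htA] at h2
      have e1 := hmono.injective h1; have e2 := hmono.injective h2; omega
    · rw [mem_singleton_iff] at h''
      have h2 := congrArg D.t h''; rw [htB, htB] at h2
      have := hmono.injective h2; omega

/-- Ribbons are simple tracks. [cite: GrimmettManolescu2014Isoradial, §4.2 (the rhombi in a track are distinct)] -/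
theorem isSimpleTrack_ribbon : emb.IsSimpleTrack (edge H x₀) :=
  ⟨isTrack_ribbon H x₀, edge_injective H x₀⟩

end Ribbon

/-- **Every track is a ribbon**: a track `r` with side sequence `s` is the ribbon through the
state `(r 0, s 0)`. [cite: GrimmettManolescu2014Isoradial, §4.2 (a track is a doubly infinite sequence of rhombi sharing opposite sides)] -/
theorem eq_ribbon_of_isTrack {r : ℤ → G.edgeSet} {s : ℤ → V × F}
    (hs : ∀ n : ℤ, s n ∈ emb.sides (r n) ∧ s n ∈ emb.sides (r (n + 1)) ∧ r n ≠ r (n + 1) ∧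
      s n = emb.oppositeSide (r n) (s (n - 1))) (n : ℤ) :
    r n = Ribbon.edge H ⟨(r 0, s 0), (hs 0).1⟩ n ∧ s n = Ribbon.exit H ⟨(r 0, s 0), (hs 0).1⟩ n := by
  set x₀ : Ribbon.St emb := ⟨(r 0, s 0), (hs 0).1⟩ with hx₀
  -- the forward step of a track is the ribbon step
  have step : ∀ m : ℤ, r m = Ribbon.edge H x₀ m → s m = Ribbon.exit H x₀ m →
      r (m + 1) = Ribbon.edge H x₀ (m + 1) ∧ s (m + 1) = Ribbon.exit H x₀ (m + 1) := by
    intro m hr hsd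
    obtain ⟨hs1, hs2, hne, -⟩ := hs m
    have hr1 : r (m + 1) = Ribbon.edge H x₀ (m + 1) := by
      rw [Ribbon.edge_succ, ← hr, ← hsd]
      exact eq_acrossEdge H (r m) hs1 hne.symm hs2 rfl
    refine ⟨hr1, ?_⟩
    obtain ⟨-, -, -, hs4⟩ := hs (m + 1)
    rw [add_sub_cancel_right] at hs4
    have hent : Ribbon.entry H x₀ (m + 1) = Ribbon.exit H x₀ m := by
      have := Ribbon.entry_eq_exit_pred H x₀ (m + 1); rw [add_sub_cancel_right] at this; exact this
    rw [hs4, hr1, hsd, ← hent, Ribbon.oppositeSide_entry]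
  -- the backward step
  have back : ∀ m : ℤ, r m = Ribbon.edge H x₀ m → s m = Ribbon.exit H x₀ m →
      r (m - 1) = Ribbon.edge H x₀ (m - 1) ∧ s (m - 1) = Ribbon.exit H x₀ (m - 1) := by
    intro m hr hsd
    obtain ⟨hs1, hs2, hne, -⟩ := hs (m - 1)
    rw [sub_add_cancel] at hs2 hne
    obtain ⟨-, -, -, hs4⟩ := hs m
    -- `s (m-1)` is the entry side of `r m = edge m`, i.e. `exit (m-1)`
    have hsm1 : s (m - 1) = Ribbon.exit H x₀ (m - 1) := by
      have h1 : emb.oppositeSide (r m) (s m) = s (m - 1) := by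
        rw [hs4, emb.oppositeSide_oppositeSide]
      rw [← h1, hr, hsd, ← Ribbon.entry_eq_exit_pred]; rfl
    refine ⟨?_, hsm1⟩
    -- `r (m-1)` is the other rhombus having the side `s (m-1)`: the one across `entry m`
    have h2 : r (m - 1) = acrossEdge H (Ribbon.edge H x₀ m) (Ribbon.entry H x₀ m) := by
      apply eq_acrossEdge H (Ribbon.edge H x₀ m) (Ribbon.entry_mem H x₀ m)
      · rw [← hr]; exact hne
      · exact hs1
      · rw [hsm1, Ribbon.entry_eq_exit_pred]
    rw [h2, Ribbon.acrossEdge_entry]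
  induction n using Int.induction_on with
  | zero => exact ⟨by simp [Ribbon.edge, Ribbon.seq_zero, hx₀], by simp [Ribbon.exit, Ribbon.seq_zero, hx₀]⟩
  | succ k ih => exact step k ih.1 ih.2
  | pred k ih =>
    have := back (-k) ih.1 ih.2
    exact this

/-- **Tracks are simple** (Grimmett–Manolescu 2014, §4.2: "the rhombi in a track are distinct";
Kenyon–Schlenker 2005, Thm 3.1: no track of a rhombic embedding crosses itself).
[cite: GrimmettManolescu2014Isoradial, §4.2 (the rhombi in a track are distinct)] -/
theorem isSimpleTrack_of_isTrack (H : PlanarTilingHyps emb ε) {r : ℤ → G.edgeSet} (hr : emb.IsTrack r) :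
    emb.IsSimpleTrack r := by
  refine ⟨hr, ?_⟩
  obtain ⟨s, hs⟩ := hr
  have heq : r = Ribbon.edge H ⟨(r 0, s 0), (hs 0).1⟩ :=
    funext fun n => (eq_ribbon_of_isTrack H hs n).1
  rw [heq]
  exact Ribbon.edge_injective H _

/-- **Through every side of every rhombus passes a track.** [cite: GrimmettManolescu2014Isoradial, §4.2 (each rhombus belongs to exactly two tracks)] -/
theorem exists_isTrack_through (e : G.edgeSet) {p : V × F} (hp : p ∈ emb.sides e) :
    ∃ r : ℤ → G.edgeSet, emb.IsSimpleTrack r ∧ r 0 = e ∧ r 1 = acrossEdge H e p := by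
  refine ⟨Ribbon.edge H ⟨(e, p), hp⟩, Ribbon.isSimpleTrack_ribbon H _, ?_, ?_⟩
  · simp [Ribbon.edge, Ribbon.seq_zero]
  · have := Ribbon.edge_succ H ⟨(e, p), hp⟩ 0
    rw [zero_add] at this; rw [this]; simp [Ribbon.edge, Ribbon.exit, Ribbon.seq_zero]

end Literature.Probability.Percolation

end

/-!
# Planarity of rhombic tilings, XI: two distinct tracks share at most one rhombus

Topic `Literature/Probability/Percolation`; theorems only. For a preconnected graph isoradially
embedded with the tiling condition and bounded angles (`PlanarTilingHyps`):

* `Ribbon.range_eq_of_parallel` — two ribbons through a common rhombus whose shared sides are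
  parallel are the same ribbon;
* `Ribbon.false_of_two_common` — **two distinct ribbons do not have two rhombi in common**
  (de Bruijn 1981, §4; Kenyon–Schlenker 2005, Thm 3.1; Grimmett–Manolescu 2014, §4.2: "two
  distinct tracks may have no more than one rhombus in common"). Proof: take two common rhombi
  consecutive along the second ribbon `R'`; the rhombi of `R'` strictly between them are not on
  `R`, hence all on one side of the strip of `R`; so `R'` leaves the first common rhombus and
  enters the second through the lateral sides of `R` on the *same* boundary line of the strip,
  i.e. it crosses `R` in opposite senses at the two rhombi — but the sense is the sign of the
  constant `Im(w w̄')` (`w`, `w'` the side directions), by the monotonicity of the transversal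
  coordinate of `R'`.
* `meetIndices_subsingleton` — for the tree's abstract tracks (`RhombicEmbedding.IsTrack`): two
  tracks that are not reparametrisations of each other meet at most once (the rendering
  assumption recorded in the docstring of `RhombicEmbedding.IsSquareGridGM`).

## References

* N. G. de Bruijn, *Algebraic theory of Penrose's non-periodic tilings*, Indag. Math. 43 (1981), §4.
* R. Kenyon, J.-M. Schlenker, *Rhombic embeddings of planar quad-graphs*, TAMS 357 (2005), Thm 3.1.
* G. R. Grimmett, I. Manolescu, *Bond percolation on isoradial graphs*, PTRF 159 (2014),
  arXiv:1204.0505, §4.2.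
-/

noncomputable section

open Complex ComplexConjugate Metric Set Filter Topology

namespace Literature.Probability.Percolation

open Literature.Probability.LatticeModels IsoradialCriticality

variable {V F : Type*} {G : SimpleGraph V} {emb : RhombicEmbedding G F} {ε : ℝ}
variable [DecidableEq V] [DecidableEq F] (H : PlanarTilingHyps emb ε)

namespace Ribbon

variable (x₀ : St emb)

/-! ### The sides of the rhombi of a ribbon, in the strip -/

/-- The entry side as a point set: `{L n, L n + w}`. [folklore] -/
theorem entry_pair_L (n : ℤ) :
    ({emb.z (entry H x₀ n).1, emb.c (entry H x₀ n).2} : Set ℂ) = {L H x₀ n, L H x₀ n + w H x₀} :=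
  (pair_L H x₀ n).symm

/-- The exit side as a point set: `{L (n+1), L (n+1) + w}`. [folklore] -/
theorem exit_pair_L (n : ℤ) :
    ({emb.z (exit H x₀ n).1, emb.c (exit H x₀ n).2} : Set ℂ) = {L H x₀ (n + 1), L H x₀ (n + 1) + w H x₀} := by
  rw [pair_L, entry_corners_succ]; rfl

/-- Transversal height of the entry corners. [folklore] -/
theorem t_of_mem_entry_pair (n : ℤ) {X : ℂ}
    (hX : X ∈ ({emb.z (entry H x₀ n).1, emb.c (entry H x₀ n).2} : Set ℂ)) :
    (stripData H x₀).t X = (stripData H x₀).tn n := by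
  rw [entry_pair_L] at hX
  rcases hX with h | h
  · rw [h]; rfl
  · rw [mem_singleton_iff] at h; rw [h]; exact (stripData H x₀).t_L_add_w n

/-- Transversal height of the exit corners. [folklore] -/
theorem t_of_mem_exit_pair (n : ℤ) {X : ℂ}
    (hX : X ∈ ({emb.z (exit H x₀ n).1, emb.c (exit H x₀ n).2} : Set ℂ)) :
    (stripData H x₀).t X = (stripData H x₀).tn (n + 1) := by
  rw [exit_pair_L] at hX
  rcases hX with h | h
  · rw [h]; rfl
  · rw [mem_singleton_iff] at h; rw [h]; exact (stripData H x₀).t_L_add_w (n + 1)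

/-- **The lateral sides of a rhombus of the ribbon**: a side other than the entry and exit sides
is `[L n, L (n+1)]` (on the boundary `a = 0`) or `[L n + w, L (n+1) + w]` (on `a = 1`). [folklore] -/
theorem lateral_cases (n : ℤ) {s : V × F} (hs : s ∈ emb.sides (edge H x₀ n))
    (h1 : s ≠ entry H x₀ n) (h2 : s ≠ exit H x₀ n) :
    (({emb.z s.1, emb.c s.2} : Set ℂ) = {L H x₀ n, L H x₀ (n + 1)} ∧
        (stripData H x₀).a (emb.z s.1) = 0 ∧ (stripData H x₀).a (emb.c s.2) = 0) ∨
    (({emb.z s.1, emb.c s.2} : Set ℂ) = {L H x₀ n + w H x₀, L H x₀ (n + 1) + w H x₀} ∧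
        (stripData H x₀).a (emb.z s.1) = 1 ∧ (stripData H x₀).a (emb.c s.2) = 1) := by
  set D := stripData H x₀ with hD
  have hstep := L_succ_sub H x₀ n
  have hsum := (quad H x₀ n).1.sum
  -- the side is `[A, Q]` or `[B, P]`
  have hlat : (emb.z s.1 = cA H x₀ n ∧ emb.c s.2 = cQ H x₀ n) ∨
      (emb.z s.1 = cB H x₀ n ∧ emb.c s.2 = cP H x₀ n) := by
    rcases (mem_sides_iff_of_mem H.iso (edge H x₀ n) (entry_mem H x₀ n) s).1 hs with h | h | h | h
    · exact absurd h h1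
    · rw [oppositeSide_entry] at h; exact absurd h h2
    · left; rw [h, oppositeSide_entry]; exact ⟨rfl, rfl⟩
    · right; rw [h, oppositeSide_entry]; exact ⟨rfl, rfl⟩
  have ha0 : ∀ m, D.a (L H x₀ m) = 0 := fun m => D.a_L m
  have ha1 : ∀ m, D.a (L H x₀ m + w H x₀) = 1 := fun m => D.a_L_add_w m
  rcases L_spec H x₀ n with ⟨hL, hLw, hw⟩ | ⟨hL, hLw, hw⟩
  · -- `L n = A`, `L (n+1) = Q`, `L n + w = P`, `L (n+1) + w = B`
    have hL1 : L H x₀ (n + 1) = cQ H x₀ n := by linear_combination hstep + hL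
    have hL1w : L H x₀ (n + 1) + w H x₀ = cB H x₀ n := by
      rw [hL1, ← hw]; linear_combination hsum
    rcases hlat with ⟨hz, hc⟩ | ⟨hz, hc⟩
    · left; rw [hz, hc, ← hL, ← hL1]; exact ⟨rfl, ha0 n, ha0 (n + 1)⟩
    · right; rw [hz, hc, ← hLw, ← hL1w, Set.pair_comm]; exact ⟨rfl, ha1 (n + 1), ha1 n⟩
  · -- `L n = P`, `L (n+1) = B`, `L n + w = A`, `L (n+1) + w = Q`
    have hL1 : L H x₀ (n + 1) = cB H x₀ n := by
      have : L H x₀ (n + 1) = cQ H x₀ n - cA H x₀ n + cP H x₀ n := by linear_combination hstep + hL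
      rw [this]; linear_combination hsum
    have hw' : w H x₀ = cA H x₀ n - cP H x₀ n := by linear_combination hw
    have hL1w : L H x₀ (n + 1) + w H x₀ = cQ H x₀ n := by
      rw [hL1, hw']; linear_combination (-1 : ℂ) * hsum
    rcases hlat with ⟨hz, hc⟩ | ⟨hz, hc⟩
    · right; rw [hz, hc, ← hLw, ← hL1w]; exact ⟨rfl, ha1 n, ha1 (n + 1)⟩
    · left; rw [hz, hc, ← hL, ← hL1, Set.pair_comm]; exact ⟨rfl, ha0 (n + 1), ha0 n⟩

/-- The entry and exit sides have direction `± w`. [folklore] -/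
theorem vec_of_entry_or_exit (n : ℤ) {s : V × F} (h : s = entry H x₀ n ∨ s = exit H x₀ n) :
    emb.c s.2 - emb.z s.1 = w H x₀ ∨ emb.c s.2 - emb.z s.1 = -w H x₀ := by
  rcases h with rfl | rfl
  · exact entry_vec_w H x₀ n
  · change cQ H x₀ n - cB H x₀ n = w H x₀ ∨ cQ H x₀ n - cB H x₀ n = -w H x₀
    rw [exit_vec]
    rcases entry_vec_w H x₀ n with h | h
    · right; rw [h]
    · left; rw [h, neg_neg]

/-- **A lateral side is not parallel to `w`** (its direction is the lateral step
`L (n+1) - L n`, which raises the transversal height). [folklore] -/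
theorem vec_ne_of_lateral (n : ℤ) {s : V × F} (hs : s ∈ emb.sides (edge H x₀ n))
    (h1 : s ≠ entry H x₀ n) (h2 : s ≠ exit H x₀ n) :
    emb.c s.2 - emb.z s.1 ≠ w H x₀ ∧ emb.c s.2 - emb.z s.1 ≠ -w H x₀ := by
  set D := stripData H x₀ with hD
  have hlt : D.tn n < D.tn (n + 1) := D.tn_strictMono (lt_add_one n)
  -- both endpoints' heights: `t (z s.1)`, `t (c s.2)` are `tn n`, `tn (n+1)` in some order
  have key : ∀ u : ℂ, (u = w H x₀ ∨ u = -w H x₀) → emb.c s.2 - emb.z s.1 = u → False := by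
    intro u hu heq
    have ht : D.t (emb.c s.2) = D.t (emb.z s.1) := by
      have : emb.c s.2 = emb.z s.1 + u := by rw [← heq]; ring
      rcases hu with rfl | rfl
      · rw [this]; have := D.t_add_real_mul_w (emb.z s.1) 1; push_cast at this; rw [one_mul] at this
        exact this
      · rw [this]; have := D.t_add_real_mul_w (emb.z s.1) (-1); push_cast at this
        rw [neg_one_mul] at this; exact this
    rcases lateral_cases H x₀ n hs h1 h2 with ⟨hp, -, -⟩ | ⟨hp, -, -⟩
    · have hz : emb.z s.1 ∈ ({L H x₀ n, L H x₀ (n + 1)} : Set ℂ) := by rw [← hp]; simp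
      have hc : emb.c s.2 ∈ ({L H x₀ n, L H x₀ (n + 1)} : Set ℂ) := by rw [← hp]; simp
      have hzc : emb.z s.1 ≠ emb.c s.2 := z_ne_c_of_mem_dartSides H.iso _ hs
      simp only [mem_insert_iff, mem_singleton_iff] at hz hc
      rcases hz with hz | hz <;> rcases hc with hc | hc
      · exact hzc (hz.trans hc.symm)
      · rw [hz, hc] at ht; change D.tn (n + 1) = D.tn n at ht; exact hlt.ne ht.symm
      · rw [hz, hc] at ht; change D.tn n = D.tn (n + 1) at ht; exact hlt.ne ht
      · exact hzc (hz.trans hc.symm)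
    · have hz : emb.z s.1 ∈ ({L H x₀ n + w H x₀, L H x₀ (n + 1) + w H x₀} : Set ℂ) := by rw [← hp]; simp
      have hc : emb.c s.2 ∈ ({L H x₀ n + w H x₀, L H x₀ (n + 1) + w H x₀} : Set ℂ) := by rw [← hp]; simp
      have hzc : emb.z s.1 ≠ emb.c s.2 := z_ne_c_of_mem_dartSides H.iso _ hs
      simp only [mem_insert_iff, mem_singleton_iff] at hz hc
      have e1 : D.t (L H x₀ (n + 1) + w H x₀) = D.tn (n + 1) := D.t_L_add_w (n + 1)
      have e2 : D.t (L H x₀ n + w H x₀) = D.tn n := D.t_L_add_w n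
      rcases hz with hz | hz <;> rcases hc with hc | hc
      · exact hzc (hz.trans hc.symm)
      · rw [hz, hc, e1, e2] at ht; exact hlt.ne ht.symm
      · rw [hz, hc, e1, e2] at ht; exact hlt.ne ht
      · exact hzc (hz.trans hc.symm)
  exact ⟨fun h => key _ (Or.inl rfl) h, fun h => key _ (Or.inr rfl) h⟩

/-- Bookkeeping: a vector that is `± w` and `± w'` makes `w'` parallel to `w`. [folklore] -/
theorem par_of_eq {v a b : ℂ} (h1 : v = a ∨ v = -a) (h2 : v = b ∨ v = -b) : b = a ∨ b = -a := by
  rcases h1 with rfl | rfl <;> rcases h2 with h | h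
  · left; exact h.symm
  · right; linear_combination h
  · right; linear_combination (-1 : ℂ) * h
  · left; linear_combination h

/-- The translation by `w` changes the transversal coordinate of *another* strip by the constant
`κ = Im(w w̄')`. [folklore] -/
theorem t_add_w (D' : StripData) (Y : ℂ) :
    D'.t (Y + w H x₀) = D'.t Y + (w H x₀ * conj D'.w).im := by
  have := sideFn_add_smul (D'.L 0) (D'.L 0 + D'.w) Y (w H x₀) 1
  push_cast at this; rw [one_mul, one_mul, add_sub_cancel_left] at this
  exact this

/-! ### Two ribbons -/

variable (y₀ : St emb)

/-- **Parallel ribbons through a common rhombus coincide.** [cite: Bruijn1981, §4 (a ribbon is determined by a rhombus and a side direction)] -/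
theorem range_eq_of_parallel {a i : ℤ} (h : edge H y₀ i = edge H x₀ a)
    (hpar : w H y₀ = w H x₀ ∨ w H y₀ = -w H x₀) :
    Set.range (edge H y₀) = Set.range (edge H x₀) := by
  -- the exit side of `y₀` at `i` is a `± w`-side of the common rhombus, hence entry or exit of `x₀`
  have hs : exit H y₀ i ∈ emb.sides (edge H x₀ a) := h ▸ exit_mem H y₀ i
  have hvec : emb.c (exit H y₀ i).2 - emb.z (exit H y₀ i).1 = w H x₀ ∨
      emb.c (exit H y₀ i).2 - emb.z (exit H y₀ i).1 = -w H x₀ := by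
    rcases vec_of_entry_or_exit H y₀ i (Or.inr rfl) with h1 | h1 <;> rcases hpar with h2 | h2
    · left; rw [h1, h2]
    · right; rw [h1, h2]
    · right; rw [h1, h2]
    · left; rw [h1, h2, neg_neg]
  have hcase : exit H y₀ i = entry H x₀ a ∨ exit H y₀ i = exit H x₀ a := by
    by_contra hcon
    push Not at hcon
    obtain ⟨hn1, hn2⟩ := vec_ne_of_lateral H x₀ a hs hcon.1 hcon.2
    rcases hvec with hv | hv
    · exact hn1 hv
    · exact hn2 hv
  have hseqy : Set.range (edge H (seq H y₀ i)) = Set.range (edge H y₀) := range_edge_seq H y₀ i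
  have hseqx : Set.range (edge H (seq H x₀ a)) = Set.range (edge H x₀) := range_edge_seq H x₀ a
  have hvaly : (seq H y₀ i).1 = (edge H y₀ i, exit H y₀ i) := rfl
  have hvalx : (seq H x₀ a).1 = (edge H x₀ a, exit H x₀ a) := rfl
  rcases hcase with hc | hc
  · -- `seq y₀ i = flip (seq x₀ a)`
    have : seq H y₀ i = flip (seq H x₀ a) := by
      apply Subtype.ext
      rw [hvaly, h, hc]
      rfl
    rw [← hseqy, this, range_edge_flip, hseqx]
  · have : seq H y₀ i = seq H x₀ a := by
      apply Subtype.ext; rw [hvaly, hvalx, h, hc]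
    rw [← hseqy, this, hseqx]

/-- **Two distinct ribbons do not have two rhombi in common** — the form with two common rhombi
consecutive along the second ribbon: `edge y₀ i, edge y₀ j ∈ R`, `i < j`, and no rhombus of `y₀`
strictly between them on `R`. [cite: GrimmettManolescu2014Isoradial, §4.2 (two distinct tracks have at most one rhombus in common)] -/
theorem false_of_two_common_consecutive (hne : Set.range (edge H y₀) ≠ Set.range (edge H x₀))
    {i j a b : ℤ} (hij : i < j) (ha : edge H y₀ i = edge H x₀ a) (hb : edge H y₀ j = edge H x₀ b)
    (hbetween : ∀ k, i < k → k < j → edge H y₀ k ∉ Set.range (edge H x₀)) : False := by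
  set D := stripData H x₀ with hD
  set D' := stripData H y₀ with hD'
  -- the ribbons are not parallel
  have hnpar : ¬ (w H y₀ = w H x₀ ∨ w H y₀ = -w H x₀) :=
    fun hpar => hne (range_eq_of_parallel H x₀ y₀ ha hpar)
  -- every entry/exit side of `y₀` lying in a rhombus of `x₀` is lateral for `x₀`
  have hlat : ∀ {k c : ℤ} {s : V × F}, edge H y₀ k = edge H x₀ c →
      (s = entry H y₀ k ∨ s = exit H y₀ k) → s ≠ entry H x₀ c ∧ s ≠ exit H x₀ c := by
    intro k c s hkc hs
    have hv := vec_of_entry_or_exit H y₀ k hs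
    constructor
    · rintro rfl
      exact hnpar (par_of_eq (vec_of_entry_or_exit H x₀ c (Or.inl rfl)) hv)
    · rintro rfl
      exact hnpar (par_of_eq (vec_of_entry_or_exit H x₀ c (Or.inr rfl)) hv)
  -- Case `j = i + 1`: the exit side of `y₀` at `i` leads, across, to `edge y₀ (i+1) ∈ R`: impossible
  by_cases hj : j = i + 1
  · subst hj
    have hs : exit H y₀ i ∈ emb.sides (edge H x₀ a) := ha ▸ exit_mem H y₀ i
    obtain ⟨h1, h2⟩ := hlat ha (Or.inr rfl)
    have hnot := acrossEdge_lateral_not_mem H x₀ a hs h1 h2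
    rw [← ha, acrossEdge_exit, hb] at hnot
    exact hnot ⟨b, rfl⟩
  have hj2 : i + 1 < j := lt_of_le_of_ne hij (Ne.symm hj)
  -- the intermediate rhombi are all on one side of the strip of `x₀`
  have hside : ∀ k, i < k → k < j →
      emb.rhombus (edge H y₀ k) ⊆ {Y | D.a Y ≤ 0} ∨ emb.rhombus (edge H y₀ k) ⊆ {Y | 1 ≤ D.a Y} :=
    fun k hk1 hk2 => rhombus_subset_or_subset H x₀ (hbetween k hk1 hk2)
  -- the shared side of consecutive intermediate rhombi forces the same side
  have hprop : ∀ k, i < k → k + 1 < j →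
      (emb.rhombus (edge H y₀ k) ⊆ {Y | D.a Y ≤ 0} ↔ emb.rhombus (edge H y₀ (k + 1)) ⊆ {Y | D.a Y ≤ 0}) := by
    intro k hk1 hk2
    have hsk : exit H y₀ k ∈ emb.sides (edge H y₀ k) := exit_mem H y₀ k
    have hsk1 : exit H y₀ k ∈ emb.sides (edge H y₀ (k + 1)) := by
      rw [edge_succ]; exact mem_sides_acrossEdge H _ hsk
    have hX0 : emb.z (exit H y₀ k).1 ∈ emb.rhombus (edge H y₀ k) :=
      (rhombus_refDart (edge H y₀ k)) ▸ FaultLine.segment_side_subset_rhombus H.iso hsk (left_mem_segment ℝ _ _)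
    have hX1 : emb.z (exit H y₀ k).1 ∈ emb.rhombus (edge H y₀ (k + 1)) :=
      (rhombus_refDart (edge H y₀ (k + 1))) ▸ FaultLine.segment_side_subset_rhombus H.iso hsk1 (left_mem_segment ℝ _ _)
    have hk1' : i < k + 1 := by omega
    have hk2' : k < j := by omega
    constructor
    · intro h0
      rcases hside (k + 1) hk1' hk2 with h | h
      · exact h
      · exfalso
        have a0 : D.a (emb.z (exit H y₀ k).1) ≤ 0 := h0 hX0
        have a1 : 1 ≤ D.a (emb.z (exit H y₀ k).1) := h hX1
        linarith
    · intro h0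
      rcases hside k hk1 hk2' with h | h
      · exact h
      · exfalso
        have a1 : 1 ≤ D.a (emb.z (exit H y₀ k).1) := h hX0
        have a0 : D.a (emb.z (exit H y₀ k).1) ≤ 0 := h0 hX1
        linarith
  -- all intermediate rhombi are on the side of rhombus `i + 1`
  have hall : ∀ k, i < k → k < j →
      (emb.rhombus (edge H y₀ k) ⊆ {Y | D.a Y ≤ 0} ↔ emb.rhombus (edge H y₀ (i + 1)) ⊆ {Y | D.a Y ≤ 0}) := by
    intro k hk1 hk2
    -- induction on `k - (i+1)`
    obtain ⟨m, rfl⟩ : ∃ m : ℕ, k = i + 1 + m := ⟨(k - (i + 1)).toNat, by omega⟩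
    induction m with
    | zero => simp
    | succ m ih =>
      have h1 : i < i + 1 + m := by omega
      have h2 : i + 1 + m < j := by push_cast at hk2; omega
      have := hprop (i + 1 + m) h1 (by push_cast at hk2 ⊢; omega)
      push_cast at this ih ⊢
      rw [show i + 1 + (m + 1 : ℤ) = i + 1 + m + 1 by ring]
      exact this.symm.trans (ih h1 h2)
  -- κ = Im(w_x conj w_y): the change of the `y₀`-height under translation by `w`
  set κ : ℝ := (w H x₀ * conj D'.w).im with hκ
  have htw : ∀ Y, D'.t (Y + w H x₀) = D'.t Y + κ := fun Y => t_add_w H x₀ D' Y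
  -- heights at the first common rhombus
  have hexit_i : exit H y₀ i ∈ emb.sides (edge H x₀ a) := ha ▸ exit_mem H y₀ i
  have hentry_i : entry H y₀ i ∈ emb.sides (edge H x₀ a) := ha ▸ entry_mem H y₀ i
  obtain ⟨he1, he2⟩ := hlat ha (Or.inr rfl)
  obtain ⟨hn1, hn2⟩ := hlat ha (Or.inl rfl)
  have hexit_sub : ∀ X ∈ ({emb.z (exit H y₀ i).1, emb.c (exit H y₀ i).2} : Set ℂ),
      X ∈ emb.rhombus (edge H y₀ (i + 1)) := by
    intro X hX
    have hs1 : exit H y₀ i ∈ emb.sides (edge H y₀ (i + 1)) := by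
      rw [edge_succ]; exact mem_sides_acrossEdge H _ (exit_mem H y₀ i)
    have hseg := FaultLine.segment_side_subset_rhombus H.iso hs1
    rw [rhombus_refDart] at hseg
    rcases hX with rfl | rfl
    · exact hseg (left_mem_segment ℝ _ _)
    · exact hseg (right_mem_segment ℝ _ _)
  -- heights at the second common rhombus: its entry side is the exit side of `y₀` at `j - 1`
  have hentry_j : entry H y₀ j ∈ emb.sides (edge H x₀ b) := hb ▸ entry_mem H y₀ j
  have hexit_j : exit H y₀ j ∈ emb.sides (edge H x₀ b) := hb ▸ exit_mem H y₀ j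
  obtain ⟨hm1, hm2⟩ := hlat hb (Or.inl rfl)
  obtain ⟨hx1, hx2⟩ := hlat hb (Or.inr rfl)
  have hentry_sub : ∀ X ∈ ({emb.z (entry H y₀ j).1, emb.c (entry H y₀ j).2} : Set ℂ),
      X ∈ emb.rhombus (edge H y₀ (j - 1)) := by
    intro X hX
    rw [entry_eq_exit_pred] at hX
    have hs1 : exit H y₀ (j - 1) ∈ emb.sides (edge H y₀ (j - 1)) := exit_mem H y₀ (j - 1)
    have hseg := FaultLine.segment_side_subset_rhombus H.iso hs1
    rw [rhombus_refDart] at hseg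
    rcases hX with rfl | rfl
    · exact hseg (left_mem_segment ℝ _ _)
    · exact hseg (right_mem_segment ℝ _ _)
  -- the two laterals of a rhombus of `x₀` are `[L, L']` (a = 0) and `[L + w, L' + w]` (a = 1);
  -- entry and exit of `y₀` are the two laterals, distinct
  have hdist_i : entry H y₀ i ≠ exit H y₀ i := by
    intro h; have := congrArg (emb.oppositeSide (edge H y₀ i)) h
    rw [oppositeSide_entry] at this
    -- `exit = opposite exit` contradicts the disjointness of a side and its opposite
    have hdisj := pair_oppositeSide_eq H.iso (edge H y₀ i) (exit_mem H y₀ i)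
    rw [← this, Set.inter_self] at hdisj
    exact (Set.insert_nonempty _ _).ne_empty hdisj
  have hdist_j : entry H y₀ j ≠ exit H y₀ j := by
    intro h; have := congrArg (emb.oppositeSide (edge H y₀ j)) h
    rw [oppositeSide_entry] at this
    have hdisj := pair_oppositeSide_eq H.iso (edge H y₀ j) (exit_mem H y₀ j)
    rw [← this, Set.inter_self] at hdisj
    exact (Set.insert_nonempty _ _).ne_empty hdisj
  -- `y₀`-heights: exit pair of `i` at `tn' (i+1)`, entry pair of `i` at `tn' i`; at `j` likewise
  have hlt_i : D'.tn i < D'.tn (i + 1) := D'.tn_strictMono (lt_add_one i)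
  have hlt_j : D'.tn j < D'.tn (j + 1) := D'.tn_strictMono (lt_add_one j)
  -- Now split on the side of the intermediate rhombi
  have hj1side := hall (j - 1) (by omega) (by omega)
  rcases hside (i + 1) (by omega) hj2 with hlow | hhigh
  · -- intermediate rhombi in `{a ≤ 0}`: exit_i is the `a = 0` lateral of `a`, entry_j the `a = 0` lateral of `b`
    have hjlow : emb.rhombus (edge H y₀ (j - 1)) ⊆ {Y | D.a Y ≤ 0} := hj1side.2 hlow
    -- exit side at `i`
    rcases lateral_cases H x₀ a hexit_i he1 he2 with ⟨hpe, -, -⟩ | ⟨hpe, ha1', -⟩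
    · -- entry at `i` is then the other lateral, on `a = 1`
      rcases lateral_cases H x₀ a hentry_i hn1 hn2 with ⟨hpn, -, -⟩ | ⟨hpn, -, -⟩
      · exact absurd (side_eq_of_pair_eq H.iso H.tiling _ hentry_i hexit_i (hpn.trans hpe.symm)) hdist_i
      · -- heights: `t'(L a) = tn'(i+1)` (exit), `t'(L a + w) = tn' i` (entry) ⇒ κ < 0
        have h1 : D'.t (L H x₀ a) = D'.tn (i + 1) :=
          t_of_mem_exit_pair H y₀ i (by rw [hpe]; simp)
        have h2 : D'.t (L H x₀ a + w H x₀) = D'.tn i :=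
          t_of_mem_entry_pair H y₀ i (by rw [hpn]; simp)
        have hκneg : κ < 0 := by have := htw (L H x₀ a); rw [h1, h2] at this; linarith
        -- at `j`: entry pair in `{a ≤ 0}` ⇒ entry_j = `[L b, L (b+1)]`, exit_j = `[L b + w, …]` ⇒ κ > 0
        rcases lateral_cases H x₀ b hentry_j hm1 hm2 with ⟨hqn, -, -⟩ | ⟨hqn, hb1, -⟩
        · rcases lateral_cases H x₀ b hexit_j hx1 hx2 with ⟨hqe, -, -⟩ | ⟨hqe, -, -⟩
          · exact absurd (side_eq_of_pair_eq H.iso H.tiling _ hentry_j hexit_j (hqn.trans hqe.symm)) hdist_j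
          · have h3 : D'.t (L H x₀ b) = D'.tn j := t_of_mem_entry_pair H y₀ j (by rw [hqn]; simp)
            have h4 : D'.t (L H x₀ b + w H x₀) = D'.tn (j + 1) :=
              t_of_mem_exit_pair H y₀ j (by rw [hqe]; simp)
            have := htw (L H x₀ b); rw [h3, h4] at this; linarith
        · -- entry_j on `a = 1` but inside `{a ≤ 0}`: contradiction
          have : D.a (emb.z (entry H y₀ j).1) ≤ 0 := hjlow (hentry_sub _ (by simp))
          linarith
    · -- exit_i on `a = 1` but inside `{a ≤ 0}`
      have : D.a (emb.z (exit H y₀ i).1) ≤ 0 := hlow (hexit_sub _ (by simp))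
      linarith
  · -- intermediate rhombi in `{1 ≤ a}`: the mirror image
    have hjhigh : emb.rhombus (edge H y₀ (j - 1)) ⊆ {Y | 1 ≤ D.a Y} := by
      rcases hside (j - 1) (by omega) (by omega) with h | h
      · exfalso
        have h' := hj1side.1 h
        -- rhombus `i+1` would be in both sides
        obtain ⟨hqi, hKi, -⟩ := quad H y₀ (i + 1)
        have hc : cA H y₀ (i + 1) ∈ emb.rhombus (edge H y₀ (i + 1)) := by
          rw [← hKi]; exact (corners_mem_convexHull_quad _ _ _ _).1
        have a0 : D.a (cA H y₀ (i + 1)) ≤ 0 := h' hc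
        have a1 : 1 ≤ D.a (cA H y₀ (i + 1)) := hhigh hc
        linarith
      · exact h
    rcases lateral_cases H x₀ a hexit_i he1 he2 with ⟨hpe, ha0', -⟩ | ⟨hpe, -, -⟩
    · have : 1 ≤ D.a (emb.z (exit H y₀ i).1) := hhigh (hexit_sub _ (by simp))
      linarith
    · rcases lateral_cases H x₀ a hentry_i hn1 hn2 with ⟨hpn, -, -⟩ | ⟨hpn, -, -⟩
      · -- `t'(L a + w) = tn'(i+1)` (exit), `t'(L a) = tn' i` (entry) ⇒ κ > 0
        have h1 : D'.t (L H x₀ a + w H x₀) = D'.tn (i + 1) :=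
          t_of_mem_exit_pair H y₀ i (by rw [hpe]; simp)
        have h2 : D'.t (L H x₀ a) = D'.tn i :=
          t_of_mem_entry_pair H y₀ i (by rw [hpn]; simp)
        have hκpos : 0 < κ := by have := htw (L H x₀ a); rw [h1, h2] at this; linarith
        rcases lateral_cases H x₀ b hentry_j hm1 hm2 with ⟨hqn, hb0, -⟩ | ⟨hqn, -, -⟩
        · have : 1 ≤ D.a (emb.z (entry H y₀ j).1) := hjhigh (hentry_sub _ (by simp))
          linarith
        · rcases lateral_cases H x₀ b hexit_j hx1 hx2 with ⟨hqe, -, -⟩ | ⟨hqe, -, -⟩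
          · have h3 : D'.t (L H x₀ b + w H x₀) = D'.tn j :=
              t_of_mem_entry_pair H y₀ j (by rw [hqn]; simp)
            have h4 : D'.t (L H x₀ b) = D'.tn (j + 1) := t_of_mem_exit_pair H y₀ j (by rw [hqe]; simp)
            have := htw (L H x₀ b); rw [h3, h4] at this; linarith
          · exact absurd (side_eq_of_pair_eq H.iso H.tiling _ hentry_j hexit_j (hqn.trans hqe.symm)) hdist_j
      · exact absurd (side_eq_of_pair_eq H.iso H.tiling _ hentry_i hexit_i (hpn.trans hpe.symm)) hdist_i

/-- **Two distinct ribbons have at most one rhombus in common.** [cite: GrimmettManolescu2014Isoradial, §4.2 (two distinct tracks have at most one rhombus in common)] -/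
theorem false_of_two_common (hne : Set.range (edge H y₀) ≠ Set.range (edge H x₀)) {i j : ℤ}
    (hij : i ≠ j) (hi : edge H y₀ i ∈ Set.range (edge H x₀)) (hj : edge H y₀ j ∈ Set.range (edge H x₀)) :
    False := by
  -- reduce to `i < j`
  wlog hlt : i < j generalizing i j
  · exact this hij.symm hj hi (lt_of_le_of_ne (not_lt.1 hlt) hij.symm)
  -- the first index after `i` on `R`
  have hex : ∃ m : ℕ, edge H y₀ (i + 1 + m) ∈ Set.range (edge H x₀) :=
    ⟨(j - (i + 1)).toNat, by rw [show i + 1 + ((j - (i + 1)).toNat : ℤ) = j by omega]; exact hj⟩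
  classical
  set m₀ := Nat.find hex with hm₀
  have hm₀spec : edge H y₀ (i + 1 + m₀) ∈ Set.range (edge H x₀) := Nat.find_spec hex
  have hmin : ∀ k, i < k → k < i + 1 + m₀ → edge H y₀ k ∉ Set.range (edge H x₀) := by
    intro k hk1 hk2 hk
    have : (k - (i + 1)).toNat < m₀ := by omega
    have hlt' := Nat.find_min hex this
    exact hlt' (by rw [show i + 1 + ((k - (i + 1)).toNat : ℤ) = k by omega]; exact hk)
  obtain ⟨a, ha⟩ := hi
  obtain ⟨b, hb⟩ := hm₀spec
  exact false_of_two_common_consecutive H x₀ y₀ hne (by omega) ha.symm hb.symm hmin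

end Ribbon

/-! ### Abstract tracks meet at most once -/

/-- **Two tracks that are not reparametrisations of each other meet at most once** (in the
tree's vocabulary: `meetIndices r r'` has at most one element).
[cite: GrimmettManolescu2014Isoradial, §4.2 (two distinct tracks have at most one rhombus in common)] -/
theorem meetIndices_subsingleton (H : PlanarTilingHyps emb ε) {r r' : ℤ → G.edgeSet} (hr : emb.IsTrack r)
    (hr' : emb.IsTrack r')
    (hnot : ¬ IsReparametrization r' r) : (meetIndices r' r).Subsingleton := by
  obtain ⟨s, hs⟩ := hr
  obtain ⟨s', hs'⟩ := hr'
  set x₀ : Ribbon.St emb := ⟨(r 0, s 0), (hs 0).1⟩ with hx₀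
  set y₀ : Ribbon.St emb := ⟨(r' 0, s' 0), (hs' 0).1⟩ with hy₀
  have hrx : ∀ n, r n = Ribbon.edge H x₀ n := fun n => (eq_ribbon_of_isTrack H hs n).1
  have hry : ∀ n, r' n = Ribbon.edge H y₀ n := fun n => (eq_ribbon_of_isTrack H hs' n).1
  have hsy : ∀ n, s' n = Ribbon.exit H y₀ n := fun n => (eq_ribbon_of_isTrack H hs' n).2
  -- if the ranges were equal, `r'` would be a reparametrisation of `r`
  have hne : Set.range (Ribbon.edge H y₀) ≠ Set.range (Ribbon.edge H x₀) := by
    intro heq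
    apply hnot
    -- `r' 0 = edge x₀ c` for some `c`, and `s' 0` is entry or exit of `x₀` at `c`
    have h0 : r' 0 ∈ Set.range (Ribbon.edge H x₀) := by rw [← heq, hry]; exact ⟨0, rfl⟩
    obtain ⟨c, hc⟩ := h0
    have hs0 : Ribbon.exit H y₀ 0 ∈ emb.sides (Ribbon.edge H x₀ c) := by
      rw [hc, hry]; exact Ribbon.exit_mem H y₀ 0
    have hcase : Ribbon.exit H y₀ 0 = Ribbon.entry H x₀ c ∨ Ribbon.exit H y₀ 0 = Ribbon.exit H x₀ c := by
      by_contra hcon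
      push Not at hcon
      have hnot' := Ribbon.acrossEdge_lateral_not_mem H x₀ c hs0 hcon.1 hcon.2
      rw [hc, hry, Ribbon.acrossEdge_exit] at hnot'
      exact hnot' (heq ▸ ⟨1, rfl⟩)
    have hedge0 : Ribbon.edge H y₀ 0 = Ribbon.edge H x₀ c := by rw [← hry, hc]
    rcases hcase with hcs | hcs
    · -- reversed: `r' n = r (c - n)`
      refine ⟨c, Or.inr fun n => ?_⟩
      have hseq : Ribbon.seq H y₀ 0 = Ribbon.flip (Ribbon.seq H x₀ c) := by
        apply Subtype.ext
        change (Ribbon.edge H y₀ 0, Ribbon.exit H y₀ 0) =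
          (Ribbon.edge H x₀ c, emb.oppositeSide (Ribbon.edge H x₀ c) (Ribbon.exit H x₀ c))
        rw [hedge0, hcs]; rfl
      rw [hry, hrx]
      have : Ribbon.edge H y₀ n = Ribbon.edge H (Ribbon.seq H y₀ 0) n := by
        simp only [Ribbon.edge, Ribbon.seq_seq, add_zero]
      rw [this, hseq, Ribbon.edge_flip]
      simp only [Ribbon.edge, Ribbon.seq_seq]
      congr 2; ring
    · refine ⟨c, Or.inl fun n => ?_⟩
      have hseq : Ribbon.seq H y₀ 0 = Ribbon.seq H x₀ c := by
        apply Subtype.ext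
        change (Ribbon.edge H y₀ 0, Ribbon.exit H y₀ 0) = (Ribbon.edge H x₀ c, Ribbon.exit H x₀ c)
        rw [hedge0, hcs]
      rw [hry, hrx]
      have : Ribbon.edge H y₀ n = Ribbon.edge H (Ribbon.seq H y₀ 0) n := by
        simp only [Ribbon.edge, Ribbon.seq_seq, add_zero]
      rw [this, hseq]
      simp only [Ribbon.edge, Ribbon.seq_seq]
  intro i hi j hj
  by_contra hij
  obtain ⟨n, hn⟩ := hi
  obtain ⟨m, hm⟩ := hj
  refine Ribbon.false_of_two_common H x₀ y₀ hne hij ?_ ?_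
  · rw [← hry, hn, hrx]; exact ⟨n, rfl⟩
  · rw [← hry, hm, hrx]; exact ⟨m, rfl⟩

end Literature.Probability.Percolation

end
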